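import Summits.BirchSwinnertonDyer.BirchSwinnertonDyer.Theses.ShaPrimaryTransfer
import Summits.BirchSwinnertonDyer.BirchSwinnertonDyer.Theorems.Rank1ResidualIntModelReduction
import Literature.NumberTheory.EllipticCurves.KubertTate1718SqrtNegTwoTwist
import Literature.Barriers.BirchSwinnertonDyer.AnomalousHeegnerLogWall
import Literature.NumberTheory.EllipticCurves.LutzNagellGeneralWeierstrass
import Literature.NumberTheory.EllipticCurves.BSDRootNumberSmallConductorRankProofs
import Mathlib.Tactic.NormNum.Prime
import HarnessLib

/-!
# BirchSwinnertonDyer / ShaPrimaryTransfer — crux `FiniteShaComponentTransfer` (stmt-BirchSwinnertonDyer-22356):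
# THE `ℚ(√−2)` TWIN — `W₈ = E_{17/18}^{(−8)} = [0, 2446, 0, −176256, −3883272192]`, a RANK-2 curve WITHOUT rational `5`-torsion
# with an UNCONDITIONAL door at the NON-ANOMALOUS good ordinary prime `5` (`a₅ = −1`), O unconditional, T by name, T idle under X2+X3+Kato

Helper file of prover seat `bsd-line-spt-p1` g24 (`--supports stmt-22356 --as helper`). THEOREMS ONLY; no definition, no `sorry`.
The tree's `Literature/…/KubertTate1718SqrtNegTwo{Valuations,KummerValues,Descent,Twist}` (this seat) run the complete `5`-isogeny
descent of `E_{17/18} = [1, -306, -5508, 0, 0]` over `K = ℚ(√−2)` — the THIRD quadratic field of the twist door after `ℚ(i)` (g20–g21,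
anomalous at `5`) and `ℚ(ζ₃)` (g22–g23) — at five places (`(θ)` and the conjugate pairs above the split `3, 17 ∣ mn`), box filled by three
`ℚ`-points and two `K`-points from the twist: `rank E(K) = 4`, `Ш(E ⊗ K)[5^∞] = 0`; hence for the globally minimal twist `W₈`
(`Δ = −2²³·3¹⁰·17⁵·19·179`, Kraus-minimal at `2`): **`rank W₈(ℚ) = 2`, `t₅(W₈) = 0`**, with NO `L`-function, `p`-adic or conjectural input.

* §1 `frobeniusTrace_five_W₈` (`a₅ = −1`: `#W̃₈(𝔽₅) = 7`), `goodOrdinary_five_W₈`, `printedScope_W₈` (`Red ∧ Good ∧ a₅ ≢ 1`: INSIDE the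
  printed Eisenstein scope, `5` inert in `ℚ(√−2)`);
* §2 `torsionOrder_W₈_eq_one` (`#W̃₈(𝔽₅) = 7`, `#W̃₈(𝔽₇) = 6` coprime): no rational torsion at all;
* §3 `oneFiniteShaComponent_W₈` (O, unconditional, witness `5`), `shaCorank_five_W₈`, `transfer_W₈` (**T BY NAME** ⟹ every `t_q(W₈) = 0`);
* §4 **`analyticRank_W₈_eq_mordellWeilRank`**, `analyticRank_W₈_eq_two` — granting X2 (`AnalyticRankLeSelmerCorank`), X3
  (`PadicOrderLeAnalyticRankAtOnePrime`) and the Kato bound ONLY: `ord_{s=1} L(W₈, s) = rank W₈(ℚ) = 2` — T is IDLE on this curve;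
  `analyticRank_W₈_le_two_of_X2`, **`analyticRank_W₈_eq_two_of_X2_of_GZK`** (X2 + Gross–Zagier–Kolyvagin ⇒ `r_an(W₈) = 2`).

PLACEMENT (numbers, not adjectives). Third rank-`2` twist door of the tree INSIDE the printed Eisenstein scope (after `W₅ = E_{13/14}^{(−3)}`,
`W₆ = E_{−37/152}^{(−3)}` of g23), first over `ℚ(√−2)`; the printed Eisenstein `p`-converse (Castella–Grossi–Lee–Skinner 2022, Thm. E) stops
at corank `r ∈ {0, 1}`, so `(W₈, 5)` is a certified instance of the OPEN core of T (Mordell–Weil rank `2`), in exactly the shape a rank-two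
Eisenstein converse would consume.  T is UNCHANGED (open at corank ≥ 2); X2, X3, Kato are NOT proved here; BSD is NOT proved by any of this.

## References

* [SilvermanAEC2009] J. H. Silverman, *AEC*, 2nd ed., VII.1 Remark 1.1, VII.5 Prop. 5.1, VIII.8, X.§2, Exercise 10.16.
* [Knapp1993] A. W. Knapp, *Elliptic Curves*, Ch. V §1 Thm. 5.1(c).
* [GreenbergLNM1716] R. Greenberg, LNM 1716 (1999), §1.
* [CastellaGrossiLeeSkinner2022] F. Castella, G. Grossi, J. Lee, C. Skinner, Invent. Math. 227 (2022), Thm. E.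
* [Darmon2004] H. Darmon, *Rational Points on Modular Elliptic Curves*, Thm. 3.22.
-/

-- D-0017: single-problem summit, so `Summit.BirchSwinnertonDyer.BirchSwinnertonDyer.…` repeats a namespace BY DESIGN.
set_option linter.dupNamespace false
set_option autoImplicit false

noncomputable section

open scoped Classical
open Literature.NumberTheory.EllipticCurves WeierstrassCurve
open Literature.NumberTheory.EllipticCurves.Rank1Residual
open Literature.NumberTheory.EllipticCurves.KubertTateSqrtNegTwoTwist (isElliptic_model isGloballyMinimal_model)
open Summit.BirchSwinnertonDyer.BirchSwinnertonDyer.Theses.ShaPrimaryTransfer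
open Summit.BirchSwinnertonDyer.BirchSwinnertonDyer.Rank1Residual

namespace Summit.BirchSwinnertonDyer.BirchSwinnertonDyer.Theorems.ShaPrimaryTransferSqrtNegTwoTwistDoor1718

/-! ## §1 Reduction at `5`: `#W̃₈(𝔽₅) = 7`, `a₅ = −1`, good ordinary, non-anomalous -/

/-- The tree's integral model of `W₈` is the integer equation `[1, 539, −12, −13629, −43797983]` itself. [cite: SilvermanAEC2009, VIII.8] -/
theorem integralModelInt_W₈ :
    haveI := isGloballyMinimal_model
    integralModelInt (⟨((0 : ℤ) : ℚ), ((2446 : ℤ) : ℚ), ((0 : ℤ) : ℚ), ((-176256 : ℤ) : ℚ), ((-3883272192 : ℤ) : ℚ)⟩ : WeierstrassCurve ℚ) =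
      ⟨0, 2446, 0, -176256, -3883272192⟩ := by
  haveI := isGloballyMinimal_model
  exact IntModel.integralModelInt_eq_of_map_eq _ (IntModel.map_mk_int 0 2446 0 (-176256) (-3883272192))

/-- The reduction modulo `5` of the integer model: `y² = x³ + x² + 4x + 3` over `𝔽₅`. [folklore] -/
private theorem map_zmod_five :
    (⟨0, 2446, 0, -176256, -3883272192⟩ : WeierstrassCurve ℤ).map (Int.castRingHom (ZMod 5)) =
      (⟨0, 1, 0, 4, 3⟩ : WeierstrassCurve (ZMod 5)) := by
  ext <;> simp [WeierstrassCurve.map] <;> decide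

/-- **`#W̃₈(𝔽₅) = 7`**: six affine solutions of `y² = x³ + x² + 4x + 3` over `𝔽₅` (`x ∈ {1, 3, 4}`, kernel count), plus `O`.
[cite: SilvermanAEC2009, V.2] -/
theorem natCard_point_five_W₈ :
    Nat.card (((⟨0, 2446, 0, -176256, -3883272192⟩ : WeierstrassCurve ℤ).map
      (Int.castRingHom (ZMod 5))).toAffine.Point) = 7 := by
  rw [map_zmod_five, natCard_point_eq_one_add_card (F := ZMod 5) _ (by decide)]
  have h : Fintype.card {xy : ZMod 5 × ZMod 5 //
      xy.2 ^ 2 + (⟨0, 1, 0, 4, 3⟩ : WeierstrassCurve (ZMod 5)).a₁ * xy.1 * xy.2 +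
        (⟨0, 1, 0, 4, 3⟩ : WeierstrassCurve (ZMod 5)).a₃ * xy.2 =
      xy.1 ^ 3 + (⟨0, 1, 0, 4, 3⟩ : WeierstrassCurve (ZMod 5)).a₂ * xy.1 ^ 2 +
        (⟨0, 1, 0, 4, 3⟩ : WeierstrassCurve (ZMod 5)).a₄ * xy.1 + (⟨0, 1, 0, 4, 3⟩ : WeierstrassCurve (ZMod 5)).a₆} = 6 := by
    decide +kernel
  rw [h]

/-- **`a₅(W₈) = −1`** (`= 5 + 1 − 7`; `= -a₅(E_{17/18})` since `5` is inert in `ℚ(√−2)`): NON-anomalous (`−1 ≢ 1 (mod 5)`), ordinary.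
[cite: SilvermanAEC2009, V.2 and Exercise 10.16] -/
theorem frobeniusTrace_five_W₈ :
    haveI := isGloballyMinimal_model
    (⟨((0 : ℤ) : ℚ), ((2446 : ℤ) : ℚ), ((0 : ℤ) : ℚ), ((-176256 : ℤ) : ℚ), ((-3883272192 : ℤ) : ℚ)⟩ : WeierstrassCurve ℚ).frobeniusTrace 5 = -1 := by
  haveI := isGloballyMinimal_model
  rw [IntModel.frobeniusTrace_eq integralModelInt_W₈ natCard_point_five_W₈]
  norm_num

/-- **`5` is a prime of good ORDINARY reduction of `W₈`** (`5 ∤ Δ(W₈) = −2²³·3¹⁰·17⁵·19·179`, `5 ∤ a₅ = −1`): the door prime of the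
`ℚ(√−2)`-descent is X2-admissible. [cite: SilvermanAEC2009, VII.5 Prop. 5.1(a)] -/
theorem goodOrdinary_five_W₈ :
    haveI := isGloballyMinimal_model
    haveI : Fact (Nat.Prime 5) := ⟨Nat.prime_five⟩
    (⟨((0 : ℤ) : ℚ), ((2446 : ℤ) : ℚ), ((0 : ℤ) : ℚ), ((-176256 : ℤ) : ℚ), ((-3883272192 : ℤ) : ℚ)⟩ : WeierstrassCurve ℚ).HasGoodReductionAtPrime 5 ∧
      ¬ ((5 : ℕ) : ℤ) ∣ (⟨((0 : ℤ) : ℚ), ((2446 : ℤ) : ℚ), ((0 : ℤ) : ℚ), ((-176256 : ℤ) : ℚ), ((-3883272192 : ℤ) : ℚ)⟩ :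
        WeierstrassCurve ℚ).frobeniusTrace 5 := by
  haveI := isGloballyMinimal_model
  haveI : Fact (Nat.Prime 5) := ⟨Nat.prime_five⟩
  refine ⟨hasGoodReductionAtPrime_of_not_dvd _ 5 ?_, ?_⟩
  · rw [IntModel.minimalDiscriminantInt_eq integralModelInt_W₈]
    have hΔ : (⟨0, 2446, 0, -176256, -3883272192⟩ : WeierstrassCurve ℤ).Δ = -2391958752432010297344 := by
      norm_num [WeierstrassCurve.Δ, WeierstrassCurve.b₂, WeierstrassCurve.b₄, WeierstrassCurve.b₆, WeierstrassCurve.b₈]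
    rw [hΔ]; norm_num
  · rw [frobeniusTrace_five_W₈]; decide

/-- **`(W₈, 5)` lies INSIDE the printed scope `Red ∧ Good ∧ a₅ ≢ 1 (mod 5)`** of the refereed Eisenstein `5`-converses
(`PrintedEisensteinHeegnerLogScope`, barrier file `AnomalousHeegnerLogWall`; here `a₅ = −1`) — like the Eisenstein doors, unlike every Gaussian-twist door.
[cite: CastellaGrossiLeeSkinner2022, Thm. E (hypothesis φ|G_p ≠ 1, ω)] -/
theorem printedScope_W₈ :
    haveI := isGloballyMinimal_model
    haveI : Fact (Nat.Prime 5) := ⟨Nat.prime_five⟩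
    Literature.Barriers.BirchSwinnertonDyer.PrintedEisensteinHeegnerLogScope
      (⟨((0 : ℤ) : ℚ), ((2446 : ℤ) : ℚ), ((0 : ℤ) : ℚ), ((-176256 : ℤ) : ℚ), ((-3883272192 : ℤ) : ℚ)⟩ : WeierstrassCurve ℚ) 5 := by
  haveI := isElliptic_model
  haveI := isGloballyMinimal_model
  haveI : Fact (Nat.Prime 5) := ⟨Nat.prime_five⟩
  obtain ⟨hgood, -⟩ := goodOrdinary_five_W₈
  refine ⟨KubertTateSqrtNegTwoTwist.red_five_model, hgood, ?_⟩
  rw [frobeniusTrace_five_W₈]; decide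

/-! ## §2 The rational torsion of `W₈` is trivial -/

/-- The reduction modulo `7` of the integer model: `y² = x³ + 3x² + 4x + 5` over `𝔽₇`. [folklore] -/
private theorem map_zmod_seven :
    (⟨0, 2446, 0, -176256, -3883272192⟩ : WeierstrassCurve ℤ).map (Int.castRingHom (ZMod 7)) =
      (⟨0, 3, 0, 4, 5⟩ : WeierstrassCurve (ZMod 7)) := by
  ext <;> simp [WeierstrassCurve.map] <;> decide

/-- **`#W̃₈(𝔽₇) = 6`** (`5` affine solutions of `y² = x³ + 3x² + 4x + 5` over `𝔽₇`, kernel count, plus `O`). [cite: SilvermanAEC2009, V.2] -/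
theorem natCard_point_seven_W₈ :
    Nat.card (((⟨0, 2446, 0, -176256, -3883272192⟩ : WeierstrassCurve ℤ).map
      (Int.castRingHom (ZMod 7))).toAffine.Point) = 6 := by
  rw [map_zmod_seven, natCard_point_eq_one_add_card (F := ZMod 7) _ (by decide)]
  have h : Fintype.card {xy : ZMod 7 × ZMod 7 //
      xy.2 ^ 2 + (⟨0, 3, 0, 4, 5⟩ : WeierstrassCurve (ZMod 7)).a₁ * xy.1 * xy.2 +
        (⟨0, 3, 0, 4, 5⟩ : WeierstrassCurve (ZMod 7)).a₃ * xy.2 =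
      xy.1 ^ 3 + (⟨0, 3, 0, 4, 5⟩ : WeierstrassCurve (ZMod 7)).a₂ * xy.1 ^ 2 +
        (⟨0, 3, 0, 4, 5⟩ : WeierstrassCurve (ZMod 7)).a₄ * xy.1 + (⟨0, 3, 0, 4, 5⟩ : WeierstrassCurve (ZMod 7)).a₆} = 5 := by
    decide +kernel
  rw [h]

/-- **`W₈(ℚ)_tors = 0`**: `#W₈(ℚ)_tors` divides `#W̃₈(𝔽₅) = 7` and `#W̃₈(𝔽₇) = 6` (reduction of torsion at the good odd primes `5, 7`,
tree `torsionOrder_dvd_reductionPointCount`), hence equals `1`: the twist has NO rational `5`-torsion — its door at `5` is not a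
rational-torsion door. [cite: Knapp1993, Ch. V §1 Thm. 5.1(c)] -/
theorem torsionOrder_W₈_eq_one :
    haveI := isElliptic_model
    (⟨((0 : ℤ) : ℚ), ((2446 : ℤ) : ℚ), ((0 : ℤ) : ℚ), ((-176256 : ℤ) : ℚ), ((-3883272192 : ℤ) : ℚ)⟩ : WeierstrassCurve ℚ).torsionOrder = 1 := by
  haveI := isElliptic_model
  haveI := isGloballyMinimal_model
  haveI : Fact (Nat.Prime 5) := ⟨Nat.prime_five⟩
  haveI : Fact (Nat.Prime 7) := ⟨by norm_num⟩
  have hΔ : (⟨0, 2446, 0, -176256, -3883272192⟩ : WeierstrassCurve ℤ).Δ = -2391958752432010297344 := by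
    norm_num [WeierstrassCurve.Δ, WeierstrassCurve.b₂, WeierstrassCurve.b₄, WeierstrassCurve.b₆, WeierstrassCurve.b₈]
  have h5 := LutzNagellGeneral.torsionOrder_dvd_reductionPointCount
    (⟨((0 : ℤ) : ℚ), ((2446 : ℤ) : ℚ), ((0 : ℤ) : ℚ), ((-176256 : ℤ) : ℚ), ((-3883272192 : ℤ) : ℚ)⟩ : WeierstrassCurve ℚ)
    5 (Or.inl (by decide)) (by rw [IntModel.minimalDiscriminantInt_eq integralModelInt_W₈, hΔ]; norm_num)
  have h7 := LutzNagellGeneral.torsionOrder_dvd_reductionPointCount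
    (⟨((0 : ℤ) : ℚ), ((2446 : ℤ) : ℚ), ((0 : ℤ) : ℚ), ((-176256 : ℤ) : ℚ), ((-3883272192 : ℤ) : ℚ)⟩ : WeierstrassCurve ℚ)
    7 (Or.inl (by decide)) (by rw [IntModel.minimalDiscriminantInt_eq integralModelInt_W₈, hΔ]; norm_num)
  rw [WeierstrassCurve.reductionPointCount, integralModelInt_W₈] at h5 h7
  rw [natCard_point_five_W₈] at h5
  rw [natCard_point_seven_W₈] at h7
  have h1 : (⟨((0 : ℤ) : ℚ), ((2446 : ℤ) : ℚ), ((0 : ℤ) : ℚ), ((-176256 : ℤ) : ℚ), ((-3883272192 : ℤ) : ℚ)⟩ :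
      WeierstrassCurve ℚ).torsionOrder ∣ Nat.gcd 7 6 := Nat.dvd_gcd h5 h7
  exact Nat.dvd_one.mp (by simpa using h1)

/-! ## §3 O at `W₈` (unconditional) and T by name -/

/-- **O for `W₈` with witness `p₀ = 5`, UNCONDITIONAL** (`t₅(W₈) = 0`; tree `KubertTateSqrtNegTwoTwist.door_model_cast`, by the
`5`-descent over `ℚ(√−2)` with split primes). [cite: SilvermanAEC2009, Thm. X.4.2] -/
theorem oneFiniteShaComponent_W₈ :
    haveI := isElliptic_model
    ∃ (p : ℕ) (_ : Fact p.Prime),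
      (⟨((0 : ℤ) : ℚ), ((2446 : ℤ) : ℚ), ((0 : ℤ) : ℚ), ((-176256 : ℤ) : ℚ), ((-3883272192 : ℤ) : ℚ)⟩ : WeierstrassCurve ℚ).shaCorank p = 0 := by
  haveI := isElliptic_model
  haveI := isGloballyMinimal_model
  haveI : Fact (Nat.Prime 5) := ⟨Nat.prime_five⟩
  exact ⟨5, inferInstance, KubertTateSqrtNegTwoTwist.door_model_cast.2⟩

/-- `t₅(W₈) = 0`, unconditional. [cite: SilvermanAEC2009, Thm. X.4.2] -/
theorem shaCorank_five_W₈ :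
    haveI := isElliptic_model
    haveI : Fact (Nat.Prime 5) := ⟨Nat.prime_five⟩
    (⟨((0 : ℤ) : ℚ), ((2446 : ℤ) : ℚ), ((0 : ℤ) : ℚ), ((-176256 : ℤ) : ℚ), ((-3883272192 : ℤ) : ℚ)⟩ : WeierstrassCurve ℚ).shaCorank 5 = 0 := by
  haveI := isElliptic_model
  haveI := isGloballyMinimal_model
  haveI : Fact (Nat.Prime 5) := ⟨Nat.prime_five⟩
  exact KubertTateSqrtNegTwoTwist.door_model_cast.2

/-- **T BY NAME on `W₈`**: granting `FiniteShaComponentTransfer`, every `t_q(W₈) = 0`. T itself is NOT proved (at `W₈`, a rank-`2` curve, no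
`p`-converse in print discharges it). [cite: SilvermanAEC2009, Thm. X.4.2] -/
theorem transfer_W₈ (hT : FiniteShaComponentTransfer) (q : ℕ) [Fact q.Prime] :
    haveI := isElliptic_model
    (⟨((0 : ℤ) : ℚ), ((2446 : ℤ) : ℚ), ((0 : ℤ) : ℚ), ((-176256 : ℤ) : ℚ), ((-3883272192 : ℤ) : ℚ)⟩ : WeierstrassCurve ℚ).shaCorank q = 0 := by
  haveI := isElliptic_model
  obtain ⟨p, hp, h0⟩ := oneFiniteShaComponent_W₈
  exact hT _ p q h0

/-! ## §4 T is idle on this curve: X2 + X3 + Kato give `r_an = rank = 2`; X2 + GZK give `r_an = 2` -/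

/-- **`ord_{s=1} L(W₈, s) = rank W₈(ℚ)` from X2 + X3 + Kato ALONE** (no T, no O as items): the `ℚ(√−2)`-descent opened the admissible
door `p₀ = 5` (`t₅ = 0`, good ordinary) on this globally minimal rank-`2` curve without rational `5`-torsion.  Leg 1 at `5`: X2 gives
`r_an ≤ corank Sel_{5^∞} = rank + t₅ = rank` (Greenberg's identity, tree `selmerCorank_eq_mordellWeilRank_add_holds`); leg 2 at the prime of
X3: Kato's bound `rank ≤ ord_T L_p` and X3's `ord_T L_p ≤ r_an` (the argument of KatoTransfer's `closes` / the route's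
`analyticRank_eq_mordellWeilRank_of_admissibleDoor`, inlined to keep this file route-cone clean). CONDITIONAL on the route items `hX2`, `hX3`, `hK`.
[cite: GreenbergLNM1716, §1 (pp. 54–57)] [cite: SilvermanAEC2009, Thm. X.4.2] -/
theorem analyticRank_W₈_eq_mordellWeilRank (hX2 : AnalyticRankLeSelmerCorank)
    (hX3 : PadicOrderLeAnalyticRankAtOnePrime) (hK : KatoRankBound) :
    haveI := isElliptic_model
    (⟨((0 : ℤ) : ℚ), ((2446 : ℤ) : ℚ), ((0 : ℤ) : ℚ), ((-176256 : ℤ) : ℚ), ((-3883272192 : ℤ) : ℚ)⟩ : WeierstrassCurve ℚ).analyticRank =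
      (⟨((0 : ℤ) : ℚ), ((2446 : ℤ) : ℚ), ((0 : ℤ) : ℚ), ((-176256 : ℤ) : ℚ), ((-3883272192 : ℤ) : ℚ)⟩ : WeierstrassCurve ℚ).mordellWeilRank := by
  haveI := isElliptic_model
  haveI := isGloballyMinimal_model
  haveI : Fact (Nat.Prime 5) := ⟨Nat.prime_five⟩
  have ht := shaCorank_five_W₈
  obtain ⟨hgood, hord⟩ := goodOrdinary_five_W₈
  set W := (⟨((0 : ℤ) : ℚ), ((2446 : ℤ) : ℚ), ((0 : ℤ) : ℚ), ((-176256 : ℤ) : ℚ), ((-3883272192 : ℤ) : ℚ)⟩ : WeierstrassCurve ℚ) with hW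
  -- leg 1 at the door prime `5`
  have hLB : W.analyticRank ≤ W.mordellWeilRank := by
    have hid : W.selmerCorank 5 = W.mordellWeilRank + W.shaCorank 5 := W.selmerCorank_eq_mordellWeilRank_add_holds 5
    have h2 := hX2 W 5 le_rfl hgood hord
    omega
  -- leg 2 at the prime of X3 (no `Ш` involved)
  have hUB : W.mordellWeilRank ≤ W.analyticRank := by
    obtain ⟨p, hp, h5p, hgoodp, hordp, N, hN, f, hf, hle⟩ := hX3 W
    have hp2 : p ≠ 2 := by omega
    have hordAt : IsOrdinaryAt W p := ⟨hgoodp, hordp⟩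
    have hk := hK W p hp2 hordAt f hf
    exact_mod_cast hk.trans hle
  exact le_antisymm hLB hUB

/-- **`ord_{s=1} L(W₈, s) = 2` from X2 + X3 + Kato alone** (rank `2` is unconditional, tree `KubertTateSqrtNegTwoTwist.door_model_cast`).
CONDITIONAL on `hX2`, `hX3`, `hK`; T idle; BSD for this curve is NOT thereby proved unconditionally. [cite: GreenbergLNM1716, §1 (pp. 54–57)]
[cite: SilvermanAEC2009, Exercise 10.16] -/
theorem analyticRank_W₈_eq_two (hX2 : AnalyticRankLeSelmerCorank)
    (hX3 : PadicOrderLeAnalyticRankAtOnePrime) (hK : KatoRankBound) :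
    haveI := isElliptic_model
    (⟨((0 : ℤ) : ℚ), ((2446 : ℤ) : ℚ), ((0 : ℤ) : ℚ), ((-176256 : ℤ) : ℚ), ((-3883272192 : ℤ) : ℚ)⟩ : WeierstrassCurve ℚ).analyticRank = 2 := by
  haveI := isElliptic_model
  rw [analyticRank_W₈_eq_mordellWeilRank hX2 hX3 hK]
  exact KubertTateSqrtNegTwoTwist.door_model_cast.1

/-- **Under X2 ALONE: `ord_{s=1} L(W₈, s) ≤ 2`** (leg 1 at the admissible door `5`: `r_an ≤ s₅ = rank + t₅ = 2 + 0`).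
CONDITIONAL on `hX2` only. [cite: GreenbergLNM1716, §1 (pp. 54–57)] -/
theorem analyticRank_W₈_le_two_of_X2 (hX2 : AnalyticRankLeSelmerCorank) :
    haveI := isElliptic_model
    (⟨((0 : ℤ) : ℚ), ((2446 : ℤ) : ℚ), ((0 : ℤ) : ℚ), ((-176256 : ℤ) : ℚ), ((-3883272192 : ℤ) : ℚ)⟩ : WeierstrassCurve ℚ).analyticRank ≤ 2 := by
  haveI := isElliptic_model
  haveI := isGloballyMinimal_model
  haveI : Fact (Nat.Prime 5) := ⟨Nat.prime_five⟩
  obtain ⟨hgood, hord⟩ := goodOrdinary_five_W₈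
  have h := hX2 _ 5 le_rfl hgood hord
  obtain ⟨hrk, ht⟩ := KubertTateSqrtNegTwoTwist.door_model_cast
  have hG := (⟨((0 : ℤ) : ℚ), ((2446 : ℤ) : ℚ), ((0 : ℤ) : ℚ), ((-176256 : ℤ) : ℚ), ((-3883272192 : ℤ) : ℚ)⟩ :
    WeierstrassCurve ℚ).selmerCorank_eq_mordellWeilRank_add_holds 5
  omega

/-- **Under X2 and Gross–Zagier–Kolyvagin: `ord_{s=1} L(W₈, s) = 2`** — rank `2` is unconditional, so GZK (the tree's named fact
`rank_eq_analyticRank_of_analyticRank_le_one`, a theorem in print) excludes `r_an ∈ {0, 1}`, and X2 at the door prime `5` caps `r_an ≤ 2`.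
CONDITIONAL on `hX2` (open) and `hGZK` (in print); no X3, no Kato, no T. [cite: Darmon2004, Thm. 3.22] [cite: GreenbergLNM1716, §1 (pp. 54–57)] -/
theorem analyticRank_W₈_eq_two_of_X2_of_GZK (hX2 : AnalyticRankLeSelmerCorank)
    (hGZK : rank_eq_analyticRank_of_analyticRank_le_one) :
    haveI := isElliptic_model
    (⟨((0 : ℤ) : ℚ), ((2446 : ℤ) : ℚ), ((0 : ℤ) : ℚ), ((-176256 : ℤ) : ℚ), ((-3883272192 : ℤ) : ℚ)⟩ : WeierstrassCurve ℚ).analyticRank = 2 := by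
  haveI := isElliptic_model
  refine analyticRank_eq_two_of_le_two_of_two_le_mordellWeilRank _ hGZK (analyticRank_W₈_le_two_of_X2 hX2) ?_
  rw [KubertTateSqrtNegTwoTwist.door_model_cast.1]

end Summit.BirchSwinnertonDyer.BirchSwinnertonDyer.Theorems.ShaPrimaryTransferSqrtNegTwoTwistDoor1718

end
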